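import Summits.Ventures.PercRepro.RankDistLubellMono

/-!
# PercRepro — THE LUBELL WEIGHTS OF THE RANK LEVELS, III: LUBELL MONOTONICITY FOR EVERY UP-SET, and for the
up-set of the bottom sets at every level (p9, gen 20)

The static proof of `RankDistLubellMono` goes through unchanged when the sets are restricted to an up-closed family
`P` (`UpClosedFin M P`): with `N_u(P) = Σ_{P A, ρ(A) = u} |A|!·(n − |A|)!` and
`Ψ_P(S) = Σ_{Y ⊆ cl(S) ∖ S, P(S ∪ Y)} |Y|!·(n − |S| − |Y|)!`, the plateau decomposition reads
`N_u(P) = Σ_{ρ(S) = u} ω(S)·Ψ_P(S)` (`lubellNP_eq_sum_omegaW`), `N_{u+1}(P)` is the total weight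
`ω(S)·(|S'| − 1 − |S|)!·Ψ_P(S')` of the triples `(S', x, S)` (`lubellNP_succ_eq_sum_tripleT`), and the key estimate
`Ψ_P(S) ≤ Σ_{Y ⊆ cl(S) ∖ S} Σ_{x ∉ cl(S)} |Y|!·Ψ_P(S ∪ Y ∪ {x})` (`plateauWP_le_sum`) holds because a term of `Ψ_P(S)`
has `P(S ∪ Y)`, so every `S ∪ Y ∪ {x}` is in the family and `Ψ_P(S ∪ Y ∪ {x}) = Ψ(S ∪ Y ∪ {x})`, where
`RankDistLubellMono`'s estimate applies; the other `Y` only add non-negative terms. Hence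
**`W_u(P) = Σ_{P A, ρ(A) = u} 1/C(n, |A|)` is nondecreasing in `u < ρ(E)` for every up-closed `P`**
(`lubellWP_le_succ`, `lubellWP_mono`) — in particular for the up-set generated by the bottom sets of `(p, q)`
(`lubellWP_shadow_le_succ`), at EVERY level including above the middle, where the plain one-step of the shadow fails.
Nothing here moves any window of the crux.
-/

namespace PercRepro.RankDist

open Set Finset _root_.Matroid PercRepro.ThmH

variable {α : Type} [DecidableEq α] (M : Matroid α) [M.Finite]

open scoped Classical in
/-- The rank-`u` members of the family `P`. -/
noncomputable def rankLevelFinP (P : Finset α → Prop) (u : ℕ) : Finset (Finset α) :=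
  (rankLevelFin M u).filter P

open scoped Classical in
omit [DecidableEq α] in
/-- Membership in `rankLevelFinP`. -/
lemma mem_rankLevelFinP {P : Finset α → Prop} {u : ℕ} {A : Finset α} :
    A ∈ rankLevelFinP M P u ↔ A ∈ rankLevelFin M u ∧ P A := by
  unfold rankLevelFinP
  rw [Finset.mem_filter]

open scoped Classical in
/-- `Ψ_P(S) = Σ_{Y ⊆ cl(S) ∖ S, P(S ∪ Y)} |Y|!·(n − |S| − |Y|)!`. -/
noncomputable def plateauWP (P : Finset α → Prop) (S : Finset α) : ℕ :=
  ∑ Y ∈ (clF M S \ S).powerset.filter (fun Y => P (S ∪ Y)),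
    Y.card.factorial * ((gr M).card - S.card - Y.card).factorial

/-- `N_u(P) = Σ_{P A, ρ(A) = u} |A|!·(n − |A|)!`. -/
noncomputable def lubellNP (P : Finset α → Prop) (u : ℕ) : ℕ :=
  ∑ A ∈ rankLevelFinP M P u, A.card.factorial * ((gr M).card - A.card).factorial

/-- An up-closed family of finsets: `P S → S ⊆ T ⊆ E → P T`. -/
def UpClosedFin (P : Finset α → Prop) : Prop := ∀ S T : Finset α, T ⊆ gr M → S ⊆ T → P S → P T

open scoped Classical in
/-- The rank-`u` members of `P` containing a rank-`u` set `S` are the `S ∪ Y`, `Y ⊆ cl(S) ∖ S` with `P(S ∪ Y)`. -/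
lemma filter_superset_eq_image_P {P : Finset α → Prop} {u : ℕ} {S : Finset α} (hS : S ∈ rankLevelFin M u) :
    (rankLevelFinP M P u).filter (fun A => S ⊆ A)
      = ((clF M S \ S).powerset.filter (fun Y => P (S ∪ Y))).image (fun Y => S ∪ Y) := by
  ext A
  rw [Finset.mem_filter, mem_rankLevelFinP, Finset.mem_image]
  constructor
  · rintro ⟨⟨hA, hPA⟩, hSA⟩
    have hA' : A ∈ (rankLevelFin M u).filter (fun A => S ⊆ A) := Finset.mem_filter.2 ⟨hA, hSA⟩
    rw [filter_superset_eq_image M hS, Finset.mem_image] at hA'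
    obtain ⟨Y, hY, rfl⟩ := hA'
    exact ⟨Y, Finset.mem_filter.2 ⟨hY, hPA⟩, rfl⟩
  · rintro ⟨Y, hY, rfl⟩
    rw [Finset.mem_filter] at hY
    have hA' : S ∪ Y ∈ (rankLevelFin M u).filter (fun A => S ⊆ A) := by
      rw [filter_superset_eq_image M hS, Finset.mem_image]
      exact ⟨Y, hY.1, rfl⟩
    rw [Finset.mem_filter] at hA'
    exact ⟨⟨hA'.1, hY.2⟩, hA'.2⟩

open scoped Classical in
/-- **The plateau decomposition of `N_u(P)`**: `N_u(P) = Σ_{ρ(S) = u} ω(S)·Ψ_P(S)`. -/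
theorem lubellNP_eq_sum_omegaW (P : Finset α → Prop) (u : ℕ) :
    lubellNP M P u = ∑ S ∈ rankLevelFin M u, omegaW M S * plateauWP M P S := by
  unfold lubellNP
  have h1 : ∀ A ∈ rankLevelFinP M P u, A.card.factorial * ((gr M).card - A.card).factorial
      = ∑ S ∈ spanningSubsets M A, omegaW M S * ((A.card - S.card).factorial * ((gr M).card - A.card).factorial) := by
    intro A hA
    rw [← sum_omegaW_spanning M A ((subset_gr_iff M).1 ((mem_rankLevelFin M).1 ((mem_rankLevelFinP M).1 hA).1).1),
      Finset.sum_mul]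
    exact Finset.sum_congr rfl fun S _ => by ring
  rw [Finset.sum_congr rfl h1]
  rw [Finset.sum_comm' (t' := rankLevelFin M u) (s' := fun S => (rankLevelFinP M P u).filter (fun A => S ⊆ A))]
  · refine Finset.sum_congr rfl fun S hS => ?_
    rw [← Finset.mul_sum, filter_superset_eq_image_P M hS, Finset.sum_image]
    · unfold plateauWP
      congr 1
      refine Finset.sum_congr rfl fun Y hY => ?_
      rw [Finset.mem_filter, Finset.mem_powerset] at hY
      have hdisj : Disjoint S Y := Finset.disjoint_of_subset_right hY.1 Finset.disjoint_sdiff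
      rw [Finset.card_union_of_disjoint hdisj, Nat.add_sub_cancel_left, Nat.sub_sub]
    · intro Y₁ hY₁ Y₂ hY₂ h
      rw [Finset.mem_coe, Finset.mem_filter, Finset.mem_powerset] at hY₁ hY₂
      have e1 : (S ∪ Y₁) \ S = Y₁ :=
        Finset.union_sdiff_cancel_left (Finset.disjoint_of_subset_right hY₁.1 Finset.disjoint_sdiff)
      have e2 : (S ∪ Y₂) \ S = Y₂ :=
        Finset.union_sdiff_cancel_left (Finset.disjoint_of_subset_right hY₂.1 Finset.disjoint_sdiff)
      simp only at h
      rw [← e1, ← e2, h]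
  · intro A S
    simp only [mem_rankLevelFinP, mem_rankLevelFin, mem_spanningSubsets, Finset.mem_filter]
    constructor
    · rintro ⟨⟨⟨hAE, hAu⟩, hPA⟩, hSA, hrk⟩
      exact ⟨⟨⟨⟨hAE, hAu⟩, hPA⟩, hSA⟩, hSA.trans hAE, by rw [hrk, hAu]⟩
    · rintro ⟨⟨⟨⟨hAE, hAu⟩, hPA⟩, hSA⟩, -, hSu⟩
      exact ⟨⟨⟨hAE, hAu⟩, hPA⟩, hSA, by rw [hSu, hAu]⟩

/-- The weight of a triple `(S', x, S)` in the family: `ω(S)·(|S'| − 1 − |S|)!·Ψ_P(S')`. -/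
noncomputable def tripleWeightP (P : Finset α → Prop) (t : Σ _ : Finset α, Σ _ : α, Finset α) : ℕ :=
  omegaW M t.2.2 * (t.1.card - 1 - t.2.2.card).factorial * plateauWP M P t.1

/-- **`N_{u+1}(P)` as the total weight of the triples `(S', x, S)`.** -/
lemma lubellNP_succ_eq_sum_tripleT (P : Finset α → Prop) (u : ℕ) :
    lubellNP M P (u + 1) = ∑ t ∈ tripleT M u, tripleWeightP M P t := by
  rw [lubellNP_eq_sum_omegaW, tripleT, Finset.sum_sigma]
  refine Finset.sum_congr rfl fun S' hS' => ?_
  rw [Finset.sum_sigma]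
  obtain ⟨hS'E, hS'u⟩ := (mem_rankLevelFin M).1 hS'
  have hne : S' ≠ ∅ := by
    rintro rfl
    simp [rk] at hS'u
  have hω : omegaW M S' = ∑ x ∈ coloopsOf M S', (S'.card - 1).factorial := by
    rw [omegaW, if_neg hne, Finset.sum_const, smul_eq_mul]
  rw [hω, Finset.sum_mul]
  refine Finset.sum_congr rfl fun x hx => ?_
  have hxS' : x ∈ S' := coloopsOf_subset M S' hx
  have hid := sum_omegaW_spanning M (S'.erase x)
    ((Finset.coe_subset.2 (Finset.erase_subset x S')).trans ((subset_gr_iff M).1 hS'E))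
  rw [Finset.card_erase_of_mem hxS'] at hid
  rw [← hid, Finset.sum_mul]
  rfl

open scoped Classical in
/-- For a member `S` of an up-closed family, `Ψ_P(S) = Ψ(S)`. -/
lemma plateauWP_eq_of_mem {P : Finset α → Prop} (hP : UpClosedFin M P) {S : Finset α} (hS : S ⊆ gr M) (hPS : P S) :
    plateauWP M P S = plateauW M S := by
  unfold plateauWP plateauW
  congr 1
  refine Finset.filter_true_of_mem fun Y hY => ?_
  rw [Finset.mem_powerset] at hY
  have hYcl : Y ⊆ clF M S := hY.trans Finset.sdiff_subset
  exact hP S (S ∪ Y) (Finset.union_subset hS (hYcl.trans (clF_subset_gr M S))) Finset.subset_union_left hPS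

open scoped Classical in
/-- The weight of the image triple in the family: `ω(S)·|Y|!·Ψ_P(S ∪ Y ∪ {x})`. -/
lemma tripleWeightP_tripleMap (P : Finset α → Prop) {u : ℕ} {t : Σ _ : Finset α, Σ _ : Finset α, α}
    (ht : t ∈ tripleU M u) :
    tripleWeightP M P (tripleMap t)
      = omegaW M t.1 * t.2.1.card.factorial * plateauWP M P (insert t.2.2 (t.1 ∪ t.2.1)) := by
  obtain ⟨S, Y, x⟩ := t
  unfold tripleU at ht
  simp only [Finset.mem_sigma, Finset.mem_powerset] at ht
  obtain ⟨-, -, -, hcard⟩ := insert_union_facts M ht.1 ht.2.1 ht.2.2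
  unfold tripleWeightP tripleMap
  simp only
  rw [hcard]
  have h : S.card + Y.card + 1 - 1 - S.card = Y.card := by omega
  rw [h]

open scoped Classical in
/-- **The key estimate in the family**: `Ψ_P(S) ≤ Σ_{Y ⊆ cl(S) ∖ S} Σ_{x ∉ cl(S)} |Y|!·Ψ_P(S ∪ Y ∪ {x})` for
`S` of rank `u < ρ(E)` and `P` up-closed: a term of `Ψ_P(S)` has `P(S ∪ Y)`, so `Ψ_P(S ∪ Y ∪ {x}) = Ψ(S ∪ Y ∪ {x})`
and `RankDistLubellMono`'s estimate applies; the remaining `Y` add non-negative terms. -/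
lemma plateauWP_le_sum {P : Finset α → Prop} (hP : UpClosedFin M P) {p u : ℕ} (hr : M.eRank = (p : ℕ∞))
    (hup : u < p) {S : Finset α} (hS : S ∈ rankLevelFin M u) :
    plateauWP M P S ≤ ∑ Y ∈ (clF M S \ S).powerset, ∑ x ∈ gr M \ clF M S,
      Y.card.factorial * plateauWP M P (insert x (S ∪ Y)) := by
  obtain ⟨hSE, -⟩ := (mem_rankLevelFin M).1 hS
  have hg : 0 < (gr M).card - (clF M S).card := Nat.sub_pos_of_lt (card_clF_lt M hr hup hS)
  have hgcard : (gr M \ clF M S).card = (gr M).card - (clF M S).card :=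
    Finset.card_sdiff_of_subset (clF_subset_gr M S)
  unfold plateauWP
  rw [Finset.sum_filter]
  refine Finset.sum_le_sum fun Y hY => ?_
  rw [Finset.mem_powerset] at hY
  split_ifs with hPY
  · -- `P (S ∪ Y)`: every `S ∪ Y ∪ {x}` is in the family, so `Ψ_P = Ψ` there
    rw [← Finset.mul_sum]
    refine Nat.mul_le_mul_left _ ?_
    refine Nat.le_of_mul_le_mul_left ?_ hg
    rw [Finset.mul_sum]
    calc ((gr M).card - (clF M S).card) * ((gr M).card - S.card - Y.card).factorial
        = ∑ _x ∈ gr M \ clF M S, ((gr M).card - S.card - Y.card).factorial := by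
          rw [Finset.sum_const, smul_eq_mul, hgcard]
      _ ≤ ∑ x ∈ gr M \ clF M S, ((gr M).card - (clF M S).card) * plateauWP M P (insert x (S ∪ Y)) := by
          refine Finset.sum_le_sum fun x hx => ?_
          obtain ⟨h1, -, -, hcard⟩ := insert_union_facts M hS hY hx
          have hS'E : insert x (S ∪ Y) ⊆ gr M := ((mem_rankLevelFin M).1 h1).1
          have hPS' : P (insert x (S ∪ Y)) :=
            hP (S ∪ Y) (insert x (S ∪ Y)) hS'E (Finset.subset_insert _ _) hPY
          rw [plateauWP_eq_of_mem M hP hS'E hPS']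
          have hmul := plateauW_mul M hS'E
          rw [hcard] at hmul
          have hle : (gr M).card - (clF M (insert x (S ∪ Y))).card + 1 ≤ (gr M).card - (clF M S).card := by
            have hsub : insert x (clF M S) ⊆ clF M (insert x (S ∪ Y)) := by
              refine Finset.insert_subset ?_ ((clF_mono M Finset.subset_union_left).trans
                (clF_mono M (Finset.subset_insert _ _)))
              exact subset_clF M ((subset_gr_iff M).1 hS'E) (Finset.mem_insert_self _ _)
            have hxcl : x ∉ clF M S := (Finset.mem_sdiff.1 hx).2
            have h2 := Finset.card_le_card hsub
            rw [Finset.card_insert_of_notMem hxcl] at h2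
            have h3 : (clF M (insert x (S ∪ Y))).card ≤ (gr M).card :=
              Finset.card_le_card (clF_subset_gr M _)
            omega
          have hS'card : S.card + Y.card + 1 ≤ (gr M).card := by
            rw [← hcard]; exact Finset.card_le_card hS'E
          have hfac : ((gr M).card - S.card - Y.card).factorial
              = ((gr M).card - (S.card + Y.card + 1) + 1).factorial := by
            congr 1; omega
          rw [hfac, ← hmul]
          exact Nat.mul_le_mul_right _ hle
  · exact Nat.zero_le _

/-- **LUBELL MONOTONICITY FOR AN UP-CLOSED FAMILY (integer form)**: `N_u(P) ≤ N_{u+1}(P)` for `u < ρ(E)`. -/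
theorem lubellNP_le_succ {P : Finset α → Prop} (hP : UpClosedFin M P) {p u : ℕ} (hr : M.eRank = (p : ℕ∞))
    (hup : u < p) : lubellNP M P u ≤ lubellNP M P (u + 1) := by
  classical
  rw [lubellNP_eq_sum_omegaW, lubellNP_succ_eq_sum_tripleT]
  calc ∑ S ∈ rankLevelFin M u, omegaW M S * plateauWP M P S
      ≤ ∑ S ∈ rankLevelFin M u, omegaW M S * ∑ Y ∈ (clF M S \ S).powerset, ∑ x ∈ gr M \ clF M S,
          Y.card.factorial * plateauWP M P (insert x (S ∪ Y)) :=
        Finset.sum_le_sum fun S hS => Nat.mul_le_mul_left _ (plateauWP_le_sum M hP hr hup hS)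
    _ = ∑ t ∈ tripleU M u, tripleWeightP M P (tripleMap t) := by
        unfold tripleU
        rw [Finset.sum_sigma]
        refine Finset.sum_congr rfl fun S hS => ?_
        rw [Finset.mul_sum, Finset.sum_sigma]
        refine Finset.sum_congr rfl fun Y hY => ?_
        rw [Finset.mul_sum]
        refine Finset.sum_congr rfl fun x hx => ?_
        rw [tripleWeightP_tripleMap M P (by
          unfold tripleU
          simp only [Finset.mem_sigma]
          exact ⟨hS, hY, hx⟩)]
        ring
    _ = ∑ t' ∈ (tripleU M u).image tripleMap, tripleWeightP M P t' := by
        rw [Finset.sum_image (tripleMap_injOn M u)]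
    _ ≤ ∑ t' ∈ tripleT M u, tripleWeightP M P t' := by
        refine Finset.sum_le_sum_of_subset fun t' ht' => ?_
        obtain ⟨t, ht, rfl⟩ := Finset.mem_image.1 ht'
        exact tripleMap_mem M ht

/-- **The Lubell weight of the rank level `u` inside the family `P`**: `W_u(P) = Σ_{P A, ρ(A) = u} 1/C(n, |A|)`. -/
noncomputable def lubellWP (P : Finset α → Prop) (u : ℕ) : ℚ :=
  ∑ A ∈ rankLevelFinP M P u, (1 : ℚ) / (((gr M).card).choose A.card : ℚ)

omit [DecidableEq α] in
/-- `n!·W_u(P) = N_u(P)`. -/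
lemma factorial_mul_lubellWP (P : Finset α → Prop) (u : ℕ) :
    ((gr M).card.factorial : ℚ) * lubellWP M P u = (lubellNP M P u : ℚ) := by
  unfold lubellWP lubellNP
  rw [Finset.mul_sum, Nat.cast_sum]
  refine Finset.sum_congr rfl fun A hA => ?_
  have hAn : A.card ≤ (gr M).card :=
    Finset.card_le_card ((mem_rankLevelFin M).1 ((mem_rankLevelFinP M).1 hA).1).1
  have h := Nat.choose_mul_factorial_mul_factorial hAn
  have hpos : (0 : ℚ) < (((gr M).card).choose A.card : ℚ) := by exact_mod_cast Nat.choose_pos hAn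
  rw [mul_one_div, div_eq_iff hpos.ne']
  have h' : (((gr M).card.factorial : ℕ) : ℚ)
      = ((((gr M).card).choose A.card * A.card.factorial * ((gr M).card - A.card).factorial : ℕ) : ℚ) := by
    rw [h]
  rw [h']
  push_cast
  ring

/-- **LUBELL MONOTONICITY FOR EVERY UP-CLOSED FAMILY**: `W_u(P) ≤ W_{u+1}(P)` for every `u < ρ(E)`. -/
theorem lubellWP_le_succ {P : Finset α → Prop} (hP : UpClosedFin M P) {p u : ℕ} (hr : M.eRank = (p : ℕ∞))
    (hup : u < p) : lubellWP M P u ≤ lubellWP M P (u + 1) := by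
  have hpos : (0 : ℚ) < ((gr M).card.factorial : ℚ) := by exact_mod_cast Nat.factorial_pos _
  have h := lubellNP_le_succ M hP hr hup
  have h' : ((gr M).card.factorial : ℚ) * lubellWP M P u ≤ ((gr M).card.factorial : ℚ) * lubellWP M P (u + 1) := by
    rw [factorial_mul_lubellWP, factorial_mul_lubellWP]
    exact_mod_cast h
  exact le_of_mul_le_mul_left h' hpos

/-- **Monotone over any range**: `W_a(P) ≤ W_b(P)` for `a ≤ b ≤ ρ(E)`. -/
theorem lubellWP_mono {P : Finset α → Prop} (hP : UpClosedFin M P) {p a b : ℕ} (hr : M.eRank = (p : ℕ∞))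
    (hab : a ≤ b) (hbp : b ≤ p) : lubellWP M P a ≤ lubellWP M P b := by
  induction b, hab using Nat.le_induction with
  | base => exact le_rfl
  | succ k hak ih => exact (ih (by omega)).trans (lubellWP_le_succ M hP hr (by omega))

/-! ## The up-set generated by the bottom sets -/

/-- The up-set generated by the bottom sets of `(p, q)`: `A ⊇ some B ∈ 𝓑`. -/
def ContainsBottom (p q : ℕ) (A : Finset α) : Prop := ∃ B ∈ PerFlat.Uq M p q, B ⊆ A

/-- It is up-closed. -/
lemma containsBottom_upClosed (p q : ℕ) : UpClosedFin M (ContainsBottom M p q) := by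
  intro S T _ hST ⟨B, hB, hBS⟩
  exact ⟨B, hB, hBS.trans hST⟩

/-- **Lubell monotonicity of the shadow of the bottom sets at EVERY level**: for the up-set generated by the bottom
sets of `(p, q)` in a matroid of rank `p`, `W_u ≤ W_{u+1}` for every `u < p` — in particular above the middle,
where the plain one-step `(n − u)·s_u ≤ (u + 1)·s_{u+1}` of the shadow fails. -/
theorem lubellWP_shadow_le_succ {p q u : ℕ} (hr : M.eRank = (p : ℕ∞)) (hup : u < p) :
    lubellWP M (ContainsBottom M p q) u ≤ lubellWP M (ContainsBottom M p q) (u + 1) :=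
  lubellWP_le_succ M (containsBottom_upClosed M p q) hr hup

end PercRepro.RankDist
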